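import Summits.QuantumFields.BalabanUV.Beta.GAN24.CombForcingTwoFaceWords
import Summits.QuantumFields.BalabanUV.Beta.GAN24.CombTransportedBorder
import Summits.QuantumFields.BalabanUV.Beta.GAN24.CombRespWordsZero
import Summits.QuantumFields.BalabanUV.Beta.GAN24.WWordRespSummable

/-!
# `BalabanUV.Beta.GAN24.CombWWordZero` — binder row G-an2-4 ∕ (CONV-C), TRANSFER-III, the (III′) (C)-campaign's supplier `hB0` (memo M-1 §2 row `hB0`, VALUE side):
# **THE `K·W·K` TWO-FACE WORD OF THE COMB FORCING's ff CELL CHARGE VANISHES AT EVERY LEVEL** — the third word of leaf-01 g85's `CombForcingTwoFaceWords.zmode_combForcing_inl_inl`: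
# leaf-04's 32 (`WWordRespSummable`: the word is half the two outer-summed response words, the mixed words dying inside, GENERIC in the tables) at the transported comb tables,
# then leaf-01 g85's (L3c) at the comb data (`CombRespWordsZero`) through `CombTransportedBorder.transport_unitS` (the units commute with `𝒯`)
# (G-an2-4 CRUX TEAM (2), leaf prover `b2b-balaban-gan24-formalise-leaf-01`, gen 85; journal [LEAF01-G85-INTENT-5])

NOT IN PRINT; OUR BOOKKEEPING ([folklore] assembly BY NAME; the two covariance sockets of the transported multiplier and mixed tables typed here (d1-leaf-03's `slotPsiS` block calculus,
leaf-01 g84's `conj_psiKS_shiftK`, leaf-02 g78's `unitM_tabs_translate ∕ unitM₂_M2Of_tabs_translate`); 0 `def`, 0 cited fact, 0 `def … : Prop`, 0 sorry).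
HONEST FRAMING (cell contract, verbatim): «discharging `BetaPertH` makes Bałaban's UV stability UNCONDITIONAL — a real constructive-QFT result; it is NOT the continuum limit and NOT
the Clay problem.»  HONEST DEPENDENCY (verbatim): «continuum YM on T⁴ ⇐ BetaPertH ∧ nine spine estimates (0/9 proved); BetaPertH ⇐ (D1) ∧ (D4) ∧ CAP+tail; G-an2-4 gates asym, D1
and NE2/3/4.»

## What is proved (notation of `CombForcingTransport` ∕ `CombForcingTwoFaceWords`; `tabs = symTablesAn1S2 d Lc cΛt`, `X̃_j = unitK s_f s_m (coDressKBmAt ρ_c Lc (KInvStep Lc j))`,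
## `𝒯S̃′_j := 𝒯 (unitS s_f s_m (SpureCombOf tabs cE cVH cΛ j))`, `𝒯′M̃′_j`, `𝒯₂M̃₂′_j`, `W̃_j := W2SymOfK X̃_j Lc (𝒯S̃′_j) (𝒯′M̃′_j) 0 (𝒯₂M̃₂′_j)`)
* §1 sockets: `slotPsiS_mixed_apply`, **`slotPsiS_mixed_translate`** (the slot transport of a jointly covariant field–multiplier table is jointly covariant), `transportM_translate`,
  `transportM₂_translate`, `transportS_unitS_translate` — 32's three covariance sockets at the transported comb tables (any record).
* §2 **`sum_box_tsum_W_word_comb_eq_half_outer_resp`** — 32 AT THE COMB DATA (any record `tabs`): `Σ_{c∈box P} Σ'_{u′} FF[W̃_j μ c ν u′] = ½·Σ_{c∈box P} (resp_{ν,c;μ} + resp_{μ,c;ν})`.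
* §3 **`sum_box_tsum_W_word_an1_eq_zero`** — AT an1's RECORD: `Σ_{c∈box P} Σ'_{u′} FF[W̃_j μ c ν u′] = 0` for every level `j`, every period `P`, all units, pins, axes (§2 ⨾ the units
  commute with `𝒯` ⨾ leaf-01 g85's `respWords_transportS_add_swap_eq_zero`).
WHAT THIS IS NOT: the `E ⊗ VH`, `VH ⊗ E` (24∕27 at the comb data — (d1)_comb) and `E ⊗ E` (J2 ↔ E2) words remain; NO value of any table or charge; NOT `hB0`, NOT (d′)∕(d″); the (III′)
campaign is NOT asked (an2 W-4); NEVER «G-an2-4 closed» as (CONV-C); NOT D1, NOT `BetaPertH`, NOT continuum, NOT Clay.  2026-08-27; no existing file touched.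
-/

noncomputable section

open Finset
open scoped BigOperators
open Literature.MathematicalPhysics.QuantumFieldTheory
open Literature.MathematicalPhysics.QuantumFieldTheory.Balaban1983to89
open Literature.MathematicalPhysics.QuantumFieldTheory.Balaban1983to89.Beta
open ExpKernelCalculus (Site MKer comp shiftK VertexFamily)
open AffineAveraging (box toSite)
open AveragingContoursRooted (ctr ctrOff ctrOff_mem_box)
open AxialProjector (blk_add_zsmul)
open OneStepResolventKernel (Fib LocStencil)
open OneStepKernelFamily (KInvStep)
open SecondOrderResponse (dM K2OfK W2SymOfK LocStencilFM)
open BalabanStepW2 (M2Of)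
open Summit.QuantumFields.BalabanUV.Beta.TameKernelCalculus (trK)
open Summit.QuantumFields.BalabanUV.Beta.HessKerDressedUnits (unitK unitS)
open Summit.QuantumFields.BalabanUV.Beta.SecondOrderUnits (unitM unitM₂)
open Summit.QuantumFields.BalabanUV.Beta.AxialDressingRooted (coDressKBmAt)
open Summit.QuantumFields.BalabanUV.Beta.SymmetrisedStepJets (SymTables)
open Summit.QuantumFields.BalabanUV.Beta.SymSecondOrderTablesAn1 (symTablesAn1S2)
open Summit.QuantumFields.BalabanUV.Beta.CombChartStepJets (SpureCombOf)
open Summit.QuantumFields.BalabanUV.Beta.SymCorrectorKernel (psiKS)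
open Summit.QuantumFields.BalabanUV.Beta.SymCorrectorFace (slotPsiS slotPsiS_apply slotPsiS_shift faceWt_shift faceSum_shift faceSum)
open Summit.QuantumFields.BalabanUV.Beta.GAN24.CombTransportZeroMode (conj_psiKS_shiftK slotPsiS_translate)
open Summit.QuantumFields.BalabanUV.Beta.GAN24.CombForcingPairForm (unitS_SpureCombOf_translate unitM_tabs_translate unitM₂_M2Of_tabs_translate)
open Summit.QuantumFields.BalabanUV.Beta.GAN24.CombForcingTwoFaceWords (exists_locStencil_transport_S exists_vertexFamily_transport_M exists_locStencilFM_transport_M₂)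
open Summit.QuantumFields.BalabanUV.Beta.GAN24.CombTransportedBorder (transport_unitS pos_Lc)
open Summit.QuantumFields.BalabanUV.Beta.GAN24.CombRespWordsZero (respWords_transportS_add_swap_eq_zero)
open Summit.QuantumFields.BalabanUV.Beta.GAN24.WWordRespSummable (sum_box_tsum_W_word_eq_half_outer_resp)

namespace Summit.QuantumFields.BalabanUV.Beta.GAN24.CombWWordZero

variable {d : ℕ}

/-! ## §1 Covariance sockets of the transported tables -/

section Sockets

variable {n : ℕ} (hn : 0 < n) (r : Fin (d + 1) → ℕ)

omit hn in
/-- [folklore] **EVALUATION AT THE MULTIPLIER BOND AND THE LEGS COMMUTES WITH THE SLOT TRANSPORT** of a field–multiplier table (read as a bond family valued in bond-families of kernels):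
`(slotPsiS r n M₂ κ u) ρ w x z a b = slotPsiS r n (κ′ u′ ↦ M₂ κ′ u′ ρ w x z a b) κ u`. -/
theorem slotPsiS_mixed_apply (M₂ : Fin (d + 1) → Site (d + 1) → Fin (d + 1) → Site (d + 1) → MKer (d + 1) (Fib d)) (κ : Fin (d + 1)) (u : Site (d + 1)) (ρ : Fin (d + 1))
    (w x z : Site (d + 1)) (a b : Fib d) :
    slotPsiS r n M₂ κ u ρ w x z a b = slotPsiS r n (fun κ' u' => M₂ κ' u' ρ w x z a b) κ u := by
  simp only [SymCorrectorFace.slotPsiS, faceSum, Pi.add_apply, Pi.smul_apply, Finset.sum_apply, smul_eq_mul]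

include hn in
/-- [folklore] **THE SLOT TRANSPORT OF A JOINTLY COVARIANT FIELD–MULTIPLIER TABLE IS JOINTLY COVARIANT**: `M₂ κ (u + n•t) ρ (w + t) = shiftK (−n•t) (M₂ κ u ρ w)` for all slots
⟹ the same for `slotPsiS r n M₂` (leaf-01 g84's scalar `slotPsiS_translate`). -/
theorem slotPsiS_mixed_translate {M₂ : Fin (d + 1) → Site (d + 1) → Fin (d + 1) → Site (d + 1) → MKer (d + 1) (Fib d)}
    (hM₂t : ∀ (κ : Fin (d + 1)) (u : Site (d + 1)) (ρ : Fin (d + 1)) (w t : Site (d + 1)), M₂ κ (u + (n : ℤ) • t) ρ (w + t) = shiftK (-((n : ℤ) • t)) (M₂ κ u ρ w))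
    (κ : Fin (d + 1)) (u : Site (d + 1)) (ρ : Fin (d + 1)) (w t : Site (d + 1)) :
    slotPsiS r n M₂ κ (u + (n : ℤ) • t) ρ (w + t) = shiftK (-((n : ℤ) • t)) (slotPsiS r n M₂ κ u ρ w) := by
  funext x z a b
  have eR : shiftK (-((n : ℤ) • t)) (slotPsiS r n M₂ κ u ρ w) x z a b = slotPsiS r n M₂ κ u ρ w (x + -((n : ℤ) • t)) (z + -((n : ℤ) • t)) a b := rfl
  rw [eR, slotPsiS_mixed_apply, slotPsiS_mixed_apply]
  refine slotPsiS_translate hn r t (fun k v => ?_) κ u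
  rw [hM₂t]; rfl

end Sockets

section Comb

variable {Lc : ℕ} [NeZero Lc]

/-- [folklore] `𝒯′M̃′_i` is block-covariant (leaf-02 g78's `unitM_tabs_translate` ⨾ leaf-01 g84's `conj_psiKS_shiftK`). -/
theorem transportM_translate (tabs : SymTables d Lc) (sf sm : ℝ) (i : ℕ) (ρ' : Fin (d + 1)) (w t : Site (d + 1)) :
    (fun ρ w => comp (comp (trK (psiKS (ctrOff (d + 1) Lc) Lc)) (unitM sf sm (tabs.M i) ρ w)) (psiKS (ctrOff (d + 1) Lc) Lc)) ρ' (w + t)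
      = shiftK (-((Lc : ℤ) • t)) ((fun ρ w => comp (comp (trK (psiKS (ctrOff (d + 1) Lc) Lc)) (unitM sf sm (tabs.M i) ρ w)) (psiKS (ctrOff (d + 1) Lc) Lc)) ρ' w) := by
  simp only []
  rw [unitM_tabs_translate tabs sf sm i ρ' w t, conj_psiKS_shiftK (ctrOff (d + 1) Lc) pos_Lc]

/-- [folklore] `𝒯₂M̃₂′_i` is jointly covariant (leaf-02 g78's `unitM₂_M2Of_tabs_translate` ⨾ `slotPsiS_mixed_translate` ⨾ `conj_psiKS_shiftK`). -/
theorem transportM₂_translate (tabs : SymTables d Lc) (sf sm : ℝ) (i : ℕ) (κ : Fin (d + 1)) (u : Site (d + 1)) (ρ' : Fin (d + 1)) (w t : Site (d + 1)) :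
    (fun κ u ρ w => comp (comp (trK (psiKS (ctrOff (d + 1) Lc) Lc)) (slotPsiS (ctrOff (d + 1) Lc) Lc (unitM₂ sf sm (M2Of d Lc tabs.mixFF i)) κ u ρ w)) (psiKS (ctrOff (d + 1) Lc) Lc))
        κ (u + (Lc : ℤ) • t) ρ' (w + t)
      = shiftK (-((Lc : ℤ) • t)) ((fun κ u ρ w => comp (comp (trK (psiKS (ctrOff (d + 1) Lc) Lc)) (slotPsiS (ctrOff (d + 1) Lc) Lc (unitM₂ sf sm (M2Of d Lc tabs.mixFF i)) κ u ρ w))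
          (psiKS (ctrOff (d + 1) Lc) Lc)) κ u ρ' w) := by
  simp only []
  rw [slotPsiS_mixed_translate pos_Lc (ctrOff (d + 1) Lc) (fun κ u ρ w t => unitM₂_M2Of_tabs_translate tabs sf sm i κ u ρ w t) κ u ρ' w t,
    conj_psiKS_shiftK (ctrOff (d + 1) Lc) pos_Lc]

/-- [folklore] `𝒯S̃′_i = 𝒯 (unitS s_f s_m (SpureCombOf tabs … i))` is block-covariant (leaf-02 g78's `unitS_SpureCombOf_translate` ⨾ d1-leaf-03's `slotPsiS_shift` ⨾ `conj_psiKS_shiftK`). -/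
theorem transportS_unitS_translate (tabs : SymTables d Lc) (sf sm cE cVH cΛ : ℝ) (i : ℕ) (κ : Fin (d + 1)) (u t : Site (d + 1)) :
    (fun κ u => comp (comp (trK (psiKS (ctrOff (d + 1) Lc) Lc)) (slotPsiS (ctrOff (d + 1) Lc) Lc (unitS sf sm (SpureCombOf tabs cE cVH cΛ i)) κ u)) (psiKS (ctrOff (d + 1) Lc) Lc)) κ (u + (Lc : ℤ) • t)
      = shiftK (-((Lc : ℤ) • t)) ((fun κ u => comp (comp (trK (psiKS (ctrOff (d + 1) Lc) Lc)) (slotPsiS (ctrOff (d + 1) Lc) Lc (unitS sf sm (SpureCombOf tabs cE cVH cΛ i)) κ u))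
          (psiKS (ctrOff (d + 1) Lc) Lc)) κ u) := by
  simp only []
  rw [slotPsiS_shift pos_Lc (ctrOff (d + 1) Lc) (fun κ u t => unitS_SpureCombOf_translate tabs sf sm cE cVH cΛ i κ u t) κ u t, conj_psiKS_shiftK (ctrOff (d + 1) Lc) pos_Lc]

/-! ## §2 32 at the comb data (any record) -/

/-- NOT IN PRINT; OUR BOOKKEEPING ([folklore]; 32 AT THE COMB DATA).  For ANY `tabs : SymTables d Lc`, units, pins, every level `i`, period `P`, axes: the cell-and-lattice sum of the
`K·W·K` two-face word of the comb forcing (leaf-01 g85's `zmode_combForcing_inl_inl`, third word) is HALF THE TWO OUTER-SUMMED RESPONSE WORDS on the transported tables —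
leaf-04's `WWordRespSummable.sum_box_tsum_W_word_eq_half_outer_resp` with the sockets of `CombForcingTwoFaceWords` §1b and §1. -/
theorem sum_box_tsum_W_word_comb_eq_half_outer_resp (tabs : SymTables d Lc) (sf sm cE cVH cΛ : ℝ) (i P : ℕ) (μ ν α β : Fin (d + 1)) :
    (∑ c ∈ box (d + 1) P, ∑' u' : Site (d + 1), ∑' yw : Site (d + 1) × Site (d + 1),
        (if yw.1 α % (Lc : ℤ) = (Lc : ℤ) - 1 then (1 : ℝ) else 0) * (if yw.2 β % (Lc : ℤ) = (Lc : ℤ) - 1 then (1 : ℝ) else 0) *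
          W2SymOfK (unitK sf sm (coDressKBmAt (toSite (ctrOff (d + 1) Lc)) Lc (KInvStep (d := d) Lc i))) Lc
            (fun κ u => comp (comp (trK (psiKS (ctrOff (d + 1) Lc) Lc)) (slotPsiS (ctrOff (d + 1) Lc) Lc (unitS sf sm (SpureCombOf tabs cE cVH cΛ i)) κ u)) (psiKS (ctrOff (d + 1) Lc) Lc))
            (fun ρ w => comp (comp (trK (psiKS (ctrOff (d + 1) Lc) Lc)) (unitM sf sm (tabs.M i) ρ w)) (psiKS (ctrOff (d + 1) Lc) Lc))
            0
            (fun κ u ρ w => comp (comp (trK (psiKS (ctrOff (d + 1) Lc) Lc)) (slotPsiS (ctrOff (d + 1) Lc) Lc (unitM₂ sf sm (M2Of d Lc tabs.mixFF i)) κ u ρ w)) (psiKS (ctrOff (d + 1) Lc) Lc))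
            μ (toSite c) ν u' yw.1 yw.2 (Sum.inl α) (Sum.inl β))
      = (1 / 2 : ℝ) * ∑ c ∈ box (d + 1) P,
          ((∑' u' : Site (d + 1), ∑' yw : Site (d + 1) × Site (d + 1),
              (if yw.1 α % (Lc : ℤ) = (Lc : ℤ) - 1 then (1 : ℝ) else 0) * (if yw.2 β % (Lc : ℤ) = (Lc : ℤ) - 1 then (1 : ℝ) else 0) *
                dM (K2OfK (unitK sf sm (coDressKBmAt (toSite (ctrOff (d + 1) Lc)) Lc (KInvStep (d := d) Lc i))) Lc
                    (fun κ u => comp (comp (trK (psiKS (ctrOff (d + 1) Lc) Lc)) (slotPsiS (ctrOff (d + 1) Lc) Lc (unitS sf sm (SpureCombOf tabs cE cVH cΛ i)) κ u)) (psiKS (ctrOff (d + 1) Lc) Lc))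
                    (fun ρ w => comp (comp (trK (psiKS (ctrOff (d + 1) Lc) Lc)) (unitM sf sm (tabs.M i) ρ w)) (psiKS (ctrOff (d + 1) Lc) Lc)) ν (toSite c)) Lc
                  (fun κ u => comp (comp (trK (psiKS (ctrOff (d + 1) Lc) Lc)) (slotPsiS (ctrOff (d + 1) Lc) Lc (unitS sf sm (SpureCombOf tabs cE cVH cΛ i)) κ u)) (psiKS (ctrOff (d + 1) Lc) Lc))
                  (fun ρ w => comp (comp (trK (psiKS (ctrOff (d + 1) Lc) Lc)) (unitM sf sm (tabs.M i) ρ w)) (psiKS (ctrOff (d + 1) Lc) Lc)) μ u' yw.1 yw.2 (Sum.inl α) (Sum.inl β))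
            + ∑' u' : Site (d + 1), ∑' yw : Site (d + 1) × Site (d + 1),
              (if yw.1 α % (Lc : ℤ) = (Lc : ℤ) - 1 then (1 : ℝ) else 0) * (if yw.2 β % (Lc : ℤ) = (Lc : ℤ) - 1 then (1 : ℝ) else 0) *
                dM (K2OfK (unitK sf sm (coDressKBmAt (toSite (ctrOff (d + 1) Lc)) Lc (KInvStep (d := d) Lc i))) Lc
                    (fun κ u => comp (comp (trK (psiKS (ctrOff (d + 1) Lc) Lc)) (slotPsiS (ctrOff (d + 1) Lc) Lc (unitS sf sm (SpureCombOf tabs cE cVH cΛ i)) κ u)) (psiKS (ctrOff (d + 1) Lc) Lc))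
                    (fun ρ w => comp (comp (trK (psiKS (ctrOff (d + 1) Lc) Lc)) (unitM sf sm (tabs.M i) ρ w)) (psiKS (ctrOff (d + 1) Lc) Lc)) μ (toSite c)) Lc
                  (fun κ u => comp (comp (trK (psiKS (ctrOff (d + 1) Lc) Lc)) (slotPsiS (ctrOff (d + 1) Lc) Lc (unitS sf sm (SpureCombOf tabs cE cVH cΛ i)) κ u)) (psiKS (ctrOff (d + 1) Lc) Lc))
                  (fun ρ w => comp (comp (trK (psiKS (ctrOff (d + 1) Lc) Lc)) (unitM sf sm (tabs.M i) ρ w)) (psiKS (ctrOff (d + 1) Lc) Lc)) ν u' yw.1 yw.2 (Sum.inl α) (Sum.inl β)) := by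
  have hLc : 1 ≤ Lc := Nat.one_le_iff_ne_zero.mpr (NeZero.ne Lc)
  obtain ⟨Cs, δs, hδs, hS⟩ := exists_locStencil_transport_S tabs sf sm cE cVH cΛ i
  obtain ⟨CM, δM, hδM, hM⟩ := exists_vertexFamily_transport_M tabs sf sm i
  obtain ⟨C₂, δ₂, hδ₂, hM₂⟩ := exists_locStencilFM_transport_M₂ tabs sf sm i
  exact sum_box_tsum_W_word_eq_half_outer_resp hLc (ctrOff_mem_box pos_Lc) sf sm i hS hδs hM hδM hM₂ hδ₂
    (fun κ u ρ w t => transportM₂_translate tabs sf sm i κ u ρ w t) (fun κ u t => transportS_unitS_translate tabs sf sm cE cVH cΛ i κ u t)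
    (fun ρ' w t => transportM_translate tabs sf sm i ρ' w t) P μ ν α β

/-! ## §3 At an1's record the word vanishes -/

/-- NOT IN PRINT; OUR BOOKKEEPING ([folklore]; THE `K·W·K` WORD AT THE COMB DATA IS ZERO).  At an1's record `symTablesAn1S2 d Lc cΛt`, for all units, pins, every level `i`, period `P`,
axes `(μ,ν;α,β)`: `Σ_{c∈box P} Σ'_{u′} FF[W̃_i μ c ν u′] = 0` — §2, the units through `𝒯` (`CombTransportedBorder.transport_unitS`), and the (L3c) cancellation of the two response words on
the transported comb tables (`CombRespWordsZero.respWords_transportS_add_swap_eq_zero`, hypothesis-free at an1's record) with `M := 𝒯′M̃′_i` (block-covariant by §1). -/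
theorem sum_box_tsum_W_word_an1_eq_zero (cΛt sf sm cE cVH cΛ : ℝ) (i P : ℕ) (μ ν α β : Fin (d + 1)) :
    (∑ c ∈ box (d + 1) P, ∑' u' : Site (d + 1), ∑' yw : Site (d + 1) × Site (d + 1),
        (if yw.1 α % (Lc : ℤ) = (Lc : ℤ) - 1 then (1 : ℝ) else 0) * (if yw.2 β % (Lc : ℤ) = (Lc : ℤ) - 1 then (1 : ℝ) else 0) *
          W2SymOfK (unitK sf sm (coDressKBmAt (toSite (ctrOff (d + 1) Lc)) Lc (KInvStep (d := d) Lc i))) Lc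
            (fun κ u => comp (comp (trK (psiKS (ctrOff (d + 1) Lc) Lc)) (slotPsiS (ctrOff (d + 1) Lc) Lc (unitS sf sm (SpureCombOf (symTablesAn1S2 d Lc cΛt) cE cVH cΛ i)) κ u))
              (psiKS (ctrOff (d + 1) Lc) Lc))
            (fun ρ w => comp (comp (trK (psiKS (ctrOff (d + 1) Lc) Lc)) (unitM sf sm ((symTablesAn1S2 d Lc cΛt).M i) ρ w)) (psiKS (ctrOff (d + 1) Lc) Lc))
            0
            (fun κ u ρ w => comp (comp (trK (psiKS (ctrOff (d + 1) Lc) Lc)) (slotPsiS (ctrOff (d + 1) Lc) Lc (unitM₂ sf sm (M2Of d Lc (symTablesAn1S2 d Lc cΛt).mixFF i)) κ u ρ w))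
              (psiKS (ctrOff (d + 1) Lc) Lc))
            μ (toSite c) ν u' yw.1 yw.2 (Sum.inl α) (Sum.inl β)) = 0 := by
  obtain ⟨CM, δM, hδM, hM⟩ := exists_vertexFamily_transport_M (symTablesAn1S2 d Lc cΛt) sf sm i
  rw [sum_box_tsum_W_word_comb_eq_half_outer_resp, transport_unitS (ctrOff (d + 1) Lc) Lc sf sm]
  refine mul_eq_zero_of_right _ (Finset.sum_eq_zero fun c _ => ?_)
  rw [add_comm]
  exact respWords_transportS_add_swap_eq_zero (d := d) (Lc := Lc) sf sm cΛt cE cVH cΛ i hM hδM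
    (fun ρ' w t => transportM_translate (symTablesAn1S2 d Lc cΛt) sf sm i ρ' w t) μ ν α β (toSite c)

end Comb

end Summit.QuantumFields.BalabanUV.Beta.GAN24.CombWWordZero

end
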